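import Summits.QuantumFields.YangMills.Theorems.UnitScaleTiltProp7SymFrameGaugeResponse
import Summits.QuantumFields.YangMills.Theorems.UnitScaleTiltProp7SymAvgTwSymDefs
import Summits.QuantumFields.YangMills.Theorems.UnitScaleTiltProp7QSymGaugeCovariance
import HarnessLib

/-!
# Route `UnitScaleTilt`, crux K1 child «MinimiserStabilityRegPr» (stmt-QuantumFields-19200), skeleton v10, stub `stub_existenceMinimalOrbit` (EX), route (α) — **THE RE-BASED TWISTED
# LINEARISED AVERAGE ON GAUGE DIRECTIONS: `QTwS U₀ (D_{U₀}N) = D_{Ū₀}(N⁽ᵏ⁾)`** — [Balaban1985BackgroundPropagators] (3.114)–(3.115) p.418 «`Q_j(D_U λ) = D_{U_j}(Q′_j λ)`» for the symmetric re-based chart of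
# record, with the averaged gauge parameter `N⁽ᵏ⁾ = Q′λ` ((3.19) p.393) delivered by the frame tower (✓`Prop7SymFrameGaugeResponse` §4); sequel of FR₀ in the chart-side TRANSPORT of `hXtw‴`(iii) (LOCATE memo
# `LOCATE-TRANSPORT-LIN-w5g6.md`, operator `𝓚₀`).

Cell `ym3-torus`, width seat `ym-ust-20520-w5` (gen 6).  THEOREMS ONLY (0 `def`, 0 `sorry`).  `--supports stmt-QuantumFields-19200 --as helper`, count-neutral.  YM₃ on T³ is a ladder rung (R3), not
the Clay problem; nothing here claims the stub, the crux, d = 4 or the mass gap.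

THE POINT.  ✓`Prop7QSymGaugeCovariance.QSym_gaugeDir` (my lineage, g3): the STRAIGHT symmetric linearised average reads a gauge direction at the iterated centres, `QSym U₀ (D_{U₀}N)(c) = N(x̂ĉ₋) −
Ū₀(ĉ)N(x̂ĉ₊)Ū₀(ĉ)⁻¹`.  The chart of record is the RE-BASED TWISTED one (`QTwS U₀ = D(logChartTwS U₀)(0)`, symmetric accumulated frames (97)); along the gauge curve the frames respond (FR₀ §4:
`d∕dt|₀ v_k = N∘x̂⁽ᵏ⁾ − N⁽ᵏ⁾`, `N⁽ʲ⁺¹⁾ =` block Ad-average of `N⁽ʲ⁾`), and the twist replaces the centre values by the AVERAGED parameter: **`QTwS U₀ (D_{U₀}N)(c) = N⁽ᵏ⁾(ĉ₋) − Ū₀(ĉ)·N⁽ᵏ⁾(ĉ₊)·Ū₀(ĉ)⁻¹`**.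
Consequences for the `hsplit` residue (memo §2): the frame-corrected operator `𝓚₀ : N ↦ N∘x̂ − (frame response) = N ↦ N⁽ᵏ⁾` at the background is the `k`-fold Ad-AVERAGING (onto coarse parameters at regular
backgrounds), and the `QTwS`-invisible gauge parameters are exactly `{N⁽ᵏ⁾ covariantly constant w.r.t. Ū₀}` (print's `N(Q′) = {λ : Q′λ = 0}`, [Balaban1985BackgroundPropagators] (3.21) p.394, sits inside).

WHAT IS PROVED (sorry-free, no definition): §1 `hasDerivAt_four_factor` (product-rule letter); §3 ★★`hasDerivAt_frameAccU_of_avgSeq` (FR₀ §4 iterated along any AVERAGING SEQUENCE `ns`: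
`ns 0 = N`, `ns (j+1) y = ns j ŷ − mean_i(ns j ŷ − Ad_{Ū₀⁽ʲ⁾(Γ_{y,i})} ns j x_i)` ⟹ all-level frame response `N∘x̂⁽ᵏ⁾ − ns k`) and ★★★`QTwS_gaugeDir_of_avgSeq` ((3.19) in closed form: the twisted average of
`D_{U₀}N` is the coarse gauge direction of `ns (K−n)`); §2 ★★★`QTwS_gaugeDir_of_frameResponse (U₀) (hS : DifferentiableAt ℂ (logChartTwS U₀) 0) (N) (hF : the top-level
frame response «d∕dt|₀ frameAccU (K−n) U₀♭ (U₀♭^{exp(tN)}) x = N(x̂⁽ᴷ⁻ⁿ⁾x) − nK x»)` ⟹ `QTwS U₀ (b ↦ N(b₋) − U₀♭(b)N(b₊)U₀♭(b)⁻¹) = (c ↦ nK(ĉ₋) − Ū₀(ĉ)·nK(ĉ₊)·Ū₀(ĉ)⁻¹)` (`ĉ = bondShift c`,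
`Ū₀ = emlIterU (K−n) U₀♭`).  `hS` is ✓`differentiableAt_logChartTwS_of_regPr` at printed-regular backgrounds; `hF` is discharged level by level by FR₀ §4 (`hasDerivAt_frameAccU_zero`/`_succ`), which identifies `nK`
with the `(K−n)`-fold block Ad-average of `N`.
HONEST SCOPE: first-order bookkeeping at the background (no estimate); the proof differentiates the log-chart along the REAL gauge curve, using the exact covariance of the tower
(✓`dbarTwS_eq_dbarCovIterU_mul_inv`, ✓`dbarCovIterU_eq_gaugeActT_frameAccU`, ✓`emlIterU_gaugeActT`, ✓`expUnit_chartCurve_eventually`); nothing of print is asserted.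

References: T. Bałaban, CMP 99 (1985) 389–434 [Balaban1985BackgroundPropagators] ((3.19) p.393, (3.21) p.394, (3.114)–(3.115) p.418); CMP 98 (1985) 17–51 [Balaban1985Averaging] ((11) p.19, (89)–(92) p.31, (97) p.32);
CMP 102 (1985) 277–309 [Balaban1985Variational] ((44) p.285).
-/

set_option autoImplicit false

noncomputable section

open scoped BigOperators Topology
open Filter NormedSpace

namespace Summit.QuantumFields.YangMills.Theorems.Prop7SymAvgTwSGaugeDir

open Literature.MathematicalPhysics.QuantumFieldTheory.Balaban1983to89
open T4Continuum BlockAveraging ExpMeanLog MatrixLog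
open B10Eq27TorusAxialLog (holT holT_nil gaugeActT gaugeActT_apply)
open B7Prop1Explicit (expUnit val_expUnit val_inv_expUnit)
open Summit.QuantumFields.YangMills.Theorems.Prop7SymFrameGaugeResponse (hasDerivAt_units_inv_of_one)

variable {𝔸 : Type*} [NormedRing 𝔸] [NormedAlgebra ℂ 𝔸] [CompleteSpace 𝔸]
/-! ## §1 A product-rule letter: four unit-valued curves through `1` around a constant -/

section FourFactor

omit [CompleteSpace 𝔸] in
/-- `d∕dt|₀ [a·(b·U·c)·d·U′] = (a′U + b′U + Uc′ + Ud′)·U′` for curves `a b c d` through `1` with derivatives `a′ b′ c′ d′` (values in a normed algebra). [folklore] -/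
theorem hasDerivAt_four_factor {a b c d : ℝ → 𝔸} {a' b' c' d' : 𝔸} (U U' : 𝔸)
    (ha0 : a 0 = 1) (hb0 : b 0 = 1) (hc0 : c 0 = 1) (hd0 : d 0 = 1)
    (ha : HasDerivAt a a' 0) (hb : HasDerivAt b b' 0) (hc : HasDerivAt c c' 0) (hd : HasDerivAt d d' 0) :
    HasDerivAt (fun t : ℝ => a t * (b t * U * c t) * d t * U') ((a' * U + b' * U + U * c' + U * d') * U') 0 := by
  have h := ((ha.mul ((hb.mul_const U).mul hc)).mul hd).mul_const U'
  simp only [Pi.mul_apply, ha0, hb0, hc0, hd0, one_mul, mul_one] at h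
  refine (h.congr_deriv ?_)
  noncomm_ring

end FourFactor

/-! ## §2 The twisted linearised average on gauge directions -/

section QTwSGauge

open scoped Matrix.Norms.L2Operator
open T3ContinuumYM3Torus
open T3LevelShift (siteShift bondShift bondShift_src bondShift_tgt)
open T3PrintedRegularOrbits (sites_eq)
open T3SectALandauChart (bgUnits)
open MatrixLog (mlog mlog_one exp_mlog)
open B7TransferAnalyticMean (hasFDerivAt_mlog_one)
open Summit.QuantumFields.YangMills.Theorems.Prop8Chart (emlIterU emlIterU_gaugeActT)
open Summit.QuantumFields.YangMills.Theorems.Prop7SymAvgTwSym (frameAccU frameAccU_self dbarCovIterU dbarCovIterU_eq_gaugeActT_frameAccU dbarTwS logChartTwS QTwS QTwS_def logChartTwS_apply dbarTwS_eq_dbarCovIterU_mul_inv)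
open Summit.QuantumFields.YangMills.Theorems.Prop7QSymGaugeCovariance (hasDerivAt_mlog_conjCurve conjCurve_zero expUnit_chartCurve_eventually)
open B15DeterminingSets (embIter)

variable (F : T3Family) {n K : ℕ} (h : n ≤ K)

/-- ★★★ **`QTwS U₀ (D_{U₀}N) = D_{Ū₀}(N⁽ᵏ⁾)` — THE RE-BASED TWISTED LINEARISED AVERAGE OF A GAUGE DIRECTION IS THE COARSE GAUGE DIRECTION OF THE FRAME-CORRECTED (AVERAGED) PARAMETER.**
Let `U₀` be a background with `logChartTwS U₀` differentiable at `0` (printed-regular: ✓`differentiableAt_logChartTwS_of_regPr`), `N` a fine gauge parameter, and suppose the top-level accumulated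
frames respond to the gauge family `U₀♭^{exp(tN)}` as `d∕dt|₀ v_{K−n}(x) = N(x̂⁽ᴷ⁻ⁿ⁾x) − nK(x)` (§4, iterated from `n₀ = N`: `nK` = the `(K−n)`-fold block Ad-average of `N`).  Then for every comparison bond `c`,
`QTwS U₀ (b ↦ N(b₋) − U₀(b)N(b₊)U₀(b)⁻¹)(c) = nK(ĉ₋) − Ū₀(ĉ)·nK(ĉ₊)·Ū₀(ĉ)⁻¹` (`ĉ = bondShift c`, `Ū₀ = emlIterU (K−n) U₀♭`).  Contrast ✓`QSym_gaugeDir`: the STRAIGHT average reads the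
parameter at the centres, `N(x̂ĉ±)`; the twist replaces it by the averaged one — [Balaban1985BackgroundPropagators] (3.19) «`Q(U₀)(D_{U₀}λ) = D_{Ū₀}(Q′(U₀)λ)`» for the symmetric re-based chart.
[cite: Balaban1985BackgroundPropagators, (3.19) p.393, (3.115) p.418; Balaban1985Averaging, (11) p.19, (89)-(92) p.31, (97) p.32; Balaban1985Variational, (44) p.285] -/
theorem QTwS_gaugeDir_of_frameResponse (U₀ : GaugeField (F.P K) 0 (Matrix.specialUnitaryGroup (Fin 2) ℂ)) (hS : DifferentiableAt ℂ (logChartTwS F n K h U₀) 0)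
    (N : Site (F.P K) 0 → Matrix (Fin 2) (Fin 2) ℂ) {nK : Site (F.P K) (K - n) → Matrix (Fin 2) (Fin 2) ℂ}
    (hF : ∀ x : Site (F.P K) (K - n), HasDerivAt (fun t : ℝ =>
      ((frameAccU (K - n) (bgUnits F K U₀) (gaugeActT (fun z : Site (F.P K) 0 => expUnit (t • N z)) (bgUnits F K U₀)) x : (Matrix (Fin 2) (Fin 2) ℂ)ˣ) : Matrix (Fin 2) (Fin 2) ℂ))
      (N (embIter (K - n) x) - nK x) 0) :
    QTwS F n K h U₀ (fun b : PBond (F.P K) 0 =>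
        N b.src - ((bgUnits F K U₀ b : (Matrix (Fin 2) (Fin 2) ℂ)ˣ) : Matrix (Fin 2) (Fin 2) ℂ) * N b.tgt * (((bgUnits F K U₀ b)⁻¹ : (Matrix (Fin 2) (Fin 2) ℂ)ˣ) : Matrix (Fin 2) (Fin 2) ℂ))
      = fun c : PBond (F.P n) 0 =>
        nK (bondShift (sites_eq F n K h) c).src
          - ((emlIterU (K - n) (bgUnits F K U₀) (bondShift (sites_eq F n K h) c) : (Matrix (Fin 2) (Fin 2) ℂ)ˣ) : Matrix (Fin 2) (Fin 2) ℂ) * nK (bondShift (sites_eq F n K h) c).tgt *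
            (((emlIterU (K - n) (bgUnits F K U₀) (bondShift (sites_eq F n K h) c))⁻¹ : (Matrix (Fin 2) (Fin 2) ℂ)ˣ) : Matrix (Fin 2) (Fin 2) ℂ) := by
  -- the REAL gauge chart curve `A_t(b) = log(e^{tN(b₋)}·U₀(b)·e^{−tN(b₊)}·U₀(b)⁻¹)` and its derivative at `0`
  set A : ℝ → PBond (F.P K) 0 → Matrix (Fin 2) (Fin 2) ℂ := fun t b =>
    mlog (exp (t • N b.src) * ((bgUnits F K U₀ b : (Matrix (Fin 2) (Fin 2) ℂ)ˣ) : Matrix (Fin 2) (Fin 2) ℂ) * exp (t • (-N b.tgt))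
      * (((bgUnits F K U₀ b)⁻¹ : (Matrix (Fin 2) (Fin 2) ℂ)ˣ) : Matrix (Fin 2) (Fin 2) ℂ)) with hA
  have hA0 : A 0 = 0 := by
    funext b
    show mlog (exp ((0 : ℝ) • N b.src) * _ * exp ((0 : ℝ) • (-N b.tgt)) * _) = 0
    rw [zero_smul, zero_smul, exp_zero, one_mul, mul_one, Units.mul_inv, mlog_one]
  have hofR : HasDerivAt (Complex.ofRealCLM : ℝ → ℂ) (Complex.ofRealCLM 1) 0 := Complex.ofRealCLM.hasDerivAt
  have hA' : HasDerivAt A (fun b : PBond (F.P K) 0 =>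
      N b.src - ((bgUnits F K U₀ b : (Matrix (Fin 2) (Fin 2) ℂ)ˣ) : Matrix (Fin 2) (Fin 2) ℂ) * N b.tgt * (((bgUnits F K U₀ b)⁻¹ : (Matrix (Fin 2) (Fin 2) ℂ)ˣ) : Matrix (Fin 2) (Fin 2) ℂ)) 0 := by
    rw [hasDerivAt_pi]
    intro b
    have hc : HasDerivAt (fun t : ℂ => mlog (exp (t • N b.src) * ((bgUnits F K U₀ b : (Matrix (Fin 2) (Fin 2) ℂ)ˣ) : Matrix (Fin 2) (Fin 2) ℂ) * exp (t • (-N b.tgt))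
        * (((bgUnits F K U₀ b)⁻¹ : (Matrix (Fin 2) (Fin 2) ℂ)ˣ) : Matrix (Fin 2) (Fin 2) ℂ)))
        (N b.src - ((bgUnits F K U₀ b : (Matrix (Fin 2) (Fin 2) ℂ)ˣ) : Matrix (Fin 2) (Fin 2) ℂ) * N b.tgt * (((bgUnits F K U₀ b)⁻¹ : (Matrix (Fin 2) (Fin 2) ℂ)ˣ) : Matrix (Fin 2) (Fin 2) ℂ))
        (Complex.ofRealCLM (0 : ℝ)) := by
      rw [Complex.ofRealCLM_apply, Complex.ofReal_zero]
      exact hasDerivAt_mlog_conjCurve (N b.src) (N b.tgt) (bgUnits F K U₀ b)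
    have h2 := (hc.scomp (0 : ℝ) hofR).congr_deriv (by rw [Complex.ofRealCLM_apply, Complex.ofReal_one, one_smul])
    have hfun : (fun t : ℝ => A t b) = ((fun t : ℂ => mlog (exp (t • N b.src) * ((bgUnits F K U₀ b : (Matrix (Fin 2) (Fin 2) ℂ)ˣ) : Matrix (Fin 2) (Fin 2) ℂ) * exp (t • (-N b.tgt))
        * (((bgUnits F K U₀ b)⁻¹ : (Matrix (Fin 2) (Fin 2) ℂ)ˣ) : Matrix (Fin 2) (Fin 2) ℂ))) ∘ (Complex.ofRealCLM : ℝ → ℂ)) := by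
      funext t; simp only [hA, Function.comp_apply, Complex.ofRealCLM_apply, Complex.coe_smul]
    rw [hfun]; exact h2
  -- the chain rule through the (ℂ-differentiable) twisted log-chart, along the real curve
  have hQ : HasFDerivAt (logChartTwS F n K h U₀) (QTwS F n K h U₀) (A 0) := by rw [hA0, QTwS_def]; exact hS.hasFDerivAt
  have hchain := (hQ.restrictScalars ℝ).comp_hasDerivAt (0 : ℝ) hA'
  -- the explicit value of the log-chart along the gauge curve (covariance of the tower + the frames)
  set g : ℝ → Site (F.P K) 0 → (Matrix (Fin 2) (Fin 2) ℂ)ˣ := fun t z => expUnit (t • N z) with hg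
  set Fr : ℝ → Site (F.P K) (K - n) → (Matrix (Fin 2) (Fin 2) ℂ)ˣ := fun t x => frameAccU (K - n) (bgUnits F K U₀) (gaugeActT (g t) (bgUnits F K U₀)) x with hFr
  set Ub : PBond (F.P K) (K - n) → (Matrix (Fin 2) (Fin 2) ℂ)ˣ := emlIterU (K - n) (bgUnits F K U₀) with hUb
  set ψ : ℝ → PBond (F.P n) 0 → Matrix (Fin 2) (Fin 2) ℂ := fun t c =>
    mlog ((((Fr t (bondShift (sites_eq F n K h) c).src)⁻¹ : (Matrix (Fin 2) (Fin 2) ℂ)ˣ) : Matrix (Fin 2) (Fin 2) ℂ)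
      * (((g t (embIter (K - n) (bondShift (sites_eq F n K h) c).src) : (Matrix (Fin 2) (Fin 2) ℂ)ˣ) : Matrix (Fin 2) (Fin 2) ℂ) * ((Ub (bondShift (sites_eq F n K h) c) : (Matrix (Fin 2) (Fin 2) ℂ)ˣ) : Matrix (Fin 2) (Fin 2) ℂ)
          * (((g t (embIter (K - n) (bondShift (sites_eq F n K h) c).tgt))⁻¹ : (Matrix (Fin 2) (Fin 2) ℂ)ˣ) : Matrix (Fin 2) (Fin 2) ℂ))
      * ((Fr t (bondShift (sites_eq F n K h) c).tgt : (Matrix (Fin 2) (Fin 2) ℂ)ˣ) : Matrix (Fin 2) (Fin 2) ℂ)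
      * (((Ub (bondShift (sites_eq F n K h) c))⁻¹ : (Matrix (Fin 2) (Fin 2) ℂ)ˣ) : Matrix (Fin 2) (Fin 2) ℂ)) with hψ
  -- (a) eventual agreement of `t ↦ logChartTwS U₀ (A t)` with `ψ`
  have hevC := expUnit_chartCurve_eventually (F := F) U₀ N
  have hevR : ∀ᶠ t : ℝ in 𝓝 0, (fun b : PBond (F.P K) 0 => expUnit (A t b) * bgUnits F K U₀ b) = gaugeActT (g t) (bgUnits F K U₀) := by
    have ht : Tendsto (Complex.ofRealCLM : ℝ → ℂ) (𝓝 0) (𝓝 0) := by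
      have := Complex.ofRealCLM.continuous.tendsto (0 : ℝ)
      rwa [Complex.ofRealCLM_apply, Complex.ofReal_zero] at this
    filter_upwards [ht.eventually hevC] with t htt
    have hAt : A t = fun b : PBond (F.P K) 0 => mlog (exp (((t : ℝ) : ℂ) • N b.src) * ((bgUnits F K U₀ b : (Matrix (Fin 2) (Fin 2) ℂ)ˣ) : Matrix (Fin 2) (Fin 2) ℂ)
        * exp (((t : ℝ) : ℂ) • (-N b.tgt)) * (((bgUnits F K U₀ b)⁻¹ : (Matrix (Fin 2) (Fin 2) ℂ)ˣ) : Matrix (Fin 2) (Fin 2) ℂ)) := by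
      funext b; simp only [hA, Complex.coe_smul]
    have hgt : g t = fun x => expUnit (((t : ℝ) : ℂ) • N x) := by
      funext x; simp only [hg, Complex.coe_smul]
    rw [hAt, hgt]
    exact htt
  have hev : (fun t : ℝ => logChartTwS F n K h U₀ (A t)) =ᶠ[𝓝 0] ψ := by
    filter_upwards [hevR] with t ht
    funext c
    have hk := emlIterU_gaugeActT (fun i => fun x : Site (F.P K) i => g t (embIter i x)) (fun i y => rfl) (bgUnits F K U₀) (K - n)
    have hus0 : (fun x : Site (F.P K) 0 => g t (embIter 0 x)) = g t := rfl
    rw [hus0] at hk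
    rw [logChartTwS_apply, dbarTwS_eq_dbarCovIterU_mul_inv, ht, dbarCovIterU_eq_gaugeActT_frameAccU, hk]
    simp only [hψ, gaugeActT_apply, Units.val_mul, inv_inv, hFr, hUb]
    rfl
  -- (b) the derivative of `ψ` at `0`
  have hg0 : ∀ z, g 0 z = 1 := fun z => by
    apply Units.ext; rw [hg, val_expUnit, zero_smul, exp_zero, Units.val_one]
  have hW0 : gaugeActT (g 0) (bgUnits F K U₀) = bgUnits F K U₀ := by
    funext b; rw [gaugeActT_apply, hg0, hg0, inv_one, one_mul, mul_one]
  have hFr0 : ∀ x, Fr 0 x = 1 := fun x => by rw [hFr]; simp only [hW0, frameAccU_self]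
  have hgd : ∀ z, HasDerivAt (fun t : ℝ => ((g t z : (Matrix (Fin 2) (Fin 2) ℂ)ˣ) : Matrix (Fin 2) (Fin 2) ℂ)) (N z) 0 := fun z => by
    have h1 := hasDerivAt_exp_smul_const' (𝕂 := ℝ) (N z) (0 : ℝ)
    simp only [zero_smul, exp_zero, mul_one] at h1
    have hfun : (fun t : ℝ => ((g t z : (Matrix (Fin 2) (Fin 2) ℂ)ˣ) : Matrix (Fin 2) (Fin 2) ℂ)) = fun t => exp (t • N z) := by
      funext t; rw [hg, val_expUnit]
    rw [hfun]; exact h1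
  have hginv : ∀ z, HasDerivAt (fun t : ℝ => (((g t z)⁻¹ : (Matrix (Fin 2) (Fin 2) ℂ)ˣ) : Matrix (Fin 2) (Fin 2) ℂ)) (-N z) 0 := fun z =>
    hasDerivAt_units_inv_of_one (h := fun t => g t z) (hg0 z) (hgd z)
  have hFrd : ∀ x, HasDerivAt (fun t : ℝ => ((Fr t x : (Matrix (Fin 2) (Fin 2) ℂ)ˣ) : Matrix (Fin 2) (Fin 2) ℂ)) (N (embIter (K - n) x) - nK x) 0 := fun x => hF x
  have hFrinv : ∀ x, HasDerivAt (fun t : ℝ => (((Fr t x)⁻¹ : (Matrix (Fin 2) (Fin 2) ℂ)ˣ) : Matrix (Fin 2) (Fin 2) ℂ)) (-(N (embIter (K - n) x) - nK x)) 0 := fun x =>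
    hasDerivAt_units_inv_of_one (h := fun t => Fr t x) (hFr0 x) (hFrd x)
  have hψ' : HasDerivAt ψ (fun c : PBond (F.P n) 0 =>
      nK (bondShift (sites_eq F n K h) c).src
        - ((Ub (bondShift (sites_eq F n K h) c) : (Matrix (Fin 2) (Fin 2) ℂ)ˣ) : Matrix (Fin 2) (Fin 2) ℂ) * nK (bondShift (sites_eq F n K h) c).tgt *
          (((Ub (bondShift (sites_eq F n K h) c))⁻¹ : (Matrix (Fin 2) (Fin 2) ℂ)ˣ) : Matrix (Fin 2) (Fin 2) ℂ)) 0 := by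
    rw [hasDerivAt_pi]
    intro c
    set s := (bondShift (sites_eq F n K h) c).src with hs
    set τ := (bondShift (sites_eq F n K h) c).tgt with hτ
    set e := bondShift (sites_eq F n K h) c with he
    set Uc : Matrix (Fin 2) (Fin 2) ℂ := ((Ub e : (Matrix (Fin 2) (Fin 2) ℂ)ˣ) : Matrix (Fin 2) (Fin 2) ℂ) with hUc
    set Ui : Matrix (Fin 2) (Fin 2) ℂ := (((Ub e)⁻¹ : (Matrix (Fin 2) (Fin 2) ℂ)ˣ) : Matrix (Fin 2) (Fin 2) ℂ) with hUi
    have hUU : Uc * Ui = 1 := by rw [hUc, hUi, Units.mul_inv]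
    -- the inside of the log: four unit curves through `1` around `Ū₀(ĉ)`
    have hZ := hasDerivAt_four_factor (a := fun t : ℝ => (((Fr t s)⁻¹ : (Matrix (Fin 2) (Fin 2) ℂ)ˣ) : Matrix (Fin 2) (Fin 2) ℂ))
      (b := fun t : ℝ => ((g t (embIter (K - n) s) : (Matrix (Fin 2) (Fin 2) ℂ)ˣ) : Matrix (Fin 2) (Fin 2) ℂ))
      (c := fun t : ℝ => (((g t (embIter (K - n) τ))⁻¹ : (Matrix (Fin 2) (Fin 2) ℂ)ˣ) : Matrix (Fin 2) (Fin 2) ℂ))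
      (d := fun t : ℝ => ((Fr t τ : (Matrix (Fin 2) (Fin 2) ℂ)ˣ) : Matrix (Fin 2) (Fin 2) ℂ)) Uc Ui
      (by simp only [hFr0, inv_one, Units.val_one]) (by simp only [hg0, Units.val_one]) (by simp only [hg0, inv_one, Units.val_one]) (by simp only [hFr0, Units.val_one])
      (hFrinv s) (hgd (embIter (K - n) s)) (hginv (embIter (K - n) τ)) (hFrd τ)
    have hZ0 : (fun t : ℝ => (((Fr t s)⁻¹ : (Matrix (Fin 2) (Fin 2) ℂ)ˣ) : Matrix (Fin 2) (Fin 2) ℂ)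
        * (((g t (embIter (K - n) s) : (Matrix (Fin 2) (Fin 2) ℂ)ˣ) : Matrix (Fin 2) (Fin 2) ℂ) * Uc * (((g t (embIter (K - n) τ))⁻¹ : (Matrix (Fin 2) (Fin 2) ℂ)ˣ) : Matrix (Fin 2) (Fin 2) ℂ))
        * ((Fr t τ : (Matrix (Fin 2) (Fin 2) ℂ)ˣ) : Matrix (Fin 2) (Fin 2) ℂ) * Ui) 0 = 1 := by
      simp only [hFr0, hg0, inv_one, Units.val_one, one_mul, mul_one, hUU]
    have hlog : HasFDerivAt (mlog : Matrix (Fin 2) (Fin 2) ℂ → Matrix (Fin 2) (Fin 2) ℂ) (1 : Matrix (Fin 2) (Fin 2) ℂ →L[ℂ] Matrix (Fin 2) (Fin 2) ℂ)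
        ((fun t : ℝ => (((Fr t s)⁻¹ : (Matrix (Fin 2) (Fin 2) ℂ)ˣ) : Matrix (Fin 2) (Fin 2) ℂ)
        * (((g t (embIter (K - n) s) : (Matrix (Fin 2) (Fin 2) ℂ)ˣ) : Matrix (Fin 2) (Fin 2) ℂ) * Uc * (((g t (embIter (K - n) τ))⁻¹ : (Matrix (Fin 2) (Fin 2) ℂ)ˣ) : Matrix (Fin 2) (Fin 2) ℂ))
        * ((Fr t τ : (Matrix (Fin 2) (Fin 2) ℂ)ˣ) : Matrix (Fin 2) (Fin 2) ℂ) * Ui) 0) := by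
      rw [hZ0]; exact hasFDerivAt_mlog_one
    have hcomp := (hlog.restrictScalars ℝ).comp_hasDerivAt (0 : ℝ) hZ
    have hfun : (fun t : ℝ => ψ t c) = (mlog : Matrix (Fin 2) (Fin 2) ℂ → Matrix (Fin 2) (Fin 2) ℂ) ∘ (fun t : ℝ => (((Fr t s)⁻¹ : (Matrix (Fin 2) (Fin 2) ℂ)ˣ) : Matrix (Fin 2) (Fin 2) ℂ)
        * (((g t (embIter (K - n) s) : (Matrix (Fin 2) (Fin 2) ℂ)ˣ) : Matrix (Fin 2) (Fin 2) ℂ) * Uc * (((g t (embIter (K - n) τ))⁻¹ : (Matrix (Fin 2) (Fin 2) ℂ)ˣ) : Matrix (Fin 2) (Fin 2) ℂ))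
        * ((Fr t τ : (Matrix (Fin 2) (Fin 2) ℂ)ˣ) : Matrix (Fin 2) (Fin 2) ℂ) * Ui) := by
      funext t; simp only [hψ, hs, hτ, he, hUc, hUi, Function.comp_apply]
    rw [hfun]
    refine hcomp.congr_deriv ?_
    rw [ContinuousLinearMap.coe_restrictScalars', ContinuousLinearMap.one_def, ContinuousLinearMap.coe_id', id]
    have key : -(N (embIter (K - n) s) - nK s) * Uc + N (embIter (K - n) s) * Uc + Uc * -N (embIter (K - n) τ) + Uc * (N (embIter (K - n) τ) - nK τ)
        = nK s * Uc - Uc * nK τ := by noncomm_ring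
    rw [key, sub_mul, mul_assoc (nK s), hUU, mul_one]
  exact (hchain.congr_of_eventuallyEq hev.symm).unique hψ'

end QTwSGauge
/-! ## §3 The whole tower from an averaging sequence, and (3.19) in closed form -/

section AvgSeq

open Summit.QuantumFields.YangMills.Theorems.Prop8Chart (emlIterU)
open Summit.QuantumFields.YangMills.Theorems.Prop7SymAvgTwSym (frameAccU QTwS logChartTwS)
open Summit.QuantumFields.YangMills.Theorems.Prop7SymFrameGaugeResponse (hasDerivAt_frameAccU_zero hasDerivAt_frameAccU_succ)
open B15DeterminingSets (embIter)
open B10Eq27TorusAxialLog (transl)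
open B7Prop1Explicit (disp)
open T3ContinuumYM3Torus
open T3LevelShift (bondShift)
open T3PrintedRegularOrbits (sites_eq)
open T3SectALandauChart (bgUnits)

variable {P : Params}

/-- ★★ **THE ACCUMULATED FRAMES ALONG A GAUGE FAMILY, ALL LEVELS**: if `ns : (j : ℕ) → (T^{(j)} → 𝔸)` is an AVERAGING SEQUENCE of the gauge parameter — `ns 0 = N` and
`ns (j+1) y = ns j ŷ − |I|⁻¹Σ_i (ns j ŷ − Ad_{Ū₀⁽ʲ⁾(Γ_{y,i})} ns j (x_i))` — then at every level `d∕dt|₀ v_k(U₀^{g_t})(x) = N(x̂⁽ᵏ⁾x) − ns k x` (FR₀ §4 iterated). [cite: Balaban1985Averaging, (97) p.32; Balaban1985BackgroundPropagators, (3.19) p.393] -/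
theorem hasDerivAt_frameAccU_of_avgSeq (U₀ : GaugeField P 0 𝔸ˣ) {g : ℝ → Site P 0 → 𝔸ˣ} {N : Site P 0 → 𝔸} (hg0 : g 0 = fun _ => 1)
    (hgd : ∀ x, HasDerivAt (fun t : ℝ => ((g t x : 𝔸ˣ) : 𝔸)) (N x) 0) (ns : (j : ℕ) → Site P j → 𝔸) (h0 : ns 0 = N)
    (hsucc : ∀ (j : ℕ) (y : Site P (j + 1)), ns (j + 1) y = ns j (emb y) - B7TransferAnalyticMean.meanCLM (Idx P) 𝔸 fun i : Idx P =>
        ns j (emb y) - ((holT (emlIterU j U₀) (emb y) (stairWord i.2.1 (off i.1)) : 𝔸ˣ) : 𝔸) * ns j (transl (emb y) (disp (stairWord i.2.1 (off i.1)))) *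
          (((holT (emlIterU j U₀) (emb y) (stairWord i.2.1 (off i.1)))⁻¹ : 𝔸ˣ) : 𝔸)) :
    ∀ (k : ℕ) (x : Site P k), HasDerivAt (fun t : ℝ => ((frameAccU k U₀ (gaugeActT (g t) U₀) x : 𝔸ˣ) : 𝔸)) (N (embIter k x) - ns k x) 0
  | 0, x => by rw [h0]; exact hasDerivAt_frameAccU_zero U₀ g N x
  | k + 1, y => by
    rw [hsucc]
    exact hasDerivAt_frameAccU_succ U₀ hg0 hgd k (hasDerivAt_frameAccU_of_avgSeq U₀ hg0 hgd ns h0 hsucc k) y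

end AvgSeq

section Closed

open scoped Matrix.Norms.L2Operator
open T3ContinuumYM3Torus
open T3LevelShift (siteShift bondShift)
open T3PrintedRegularOrbits (sites_eq)
open T3SectALandauChart (bgUnits)
open Summit.QuantumFields.YangMills.Theorems.Prop8Chart (emlIterU)
open Summit.QuantumFields.YangMills.Theorems.Prop7SymAvgTwSym (frameAccU QTwS logChartTwS)
open B15DeterminingSets (embIter)
open B10Eq27TorusAxialLog (transl)
open B7Prop1Explicit (disp)

variable (F : T3Family) {n K : ℕ} (h : n ≤ K)

/-- ★★★ **(3.19) FOR THE RE-BASED TWISTED CHART, CLOSED FORM**: for every averaging sequence `ns` of `N` against the background tower of `U₀♭` (§3),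
`QTwS U₀ (D_{U₀}N)(c) = ns_{K−n}(ĉ₋) − Ū₀(ĉ)·ns_{K−n}(ĉ₊)·Ū₀(ĉ)⁻¹`. [cite: Balaban1985BackgroundPropagators, (3.19) p.393, (3.115) p.418; Balaban1985Averaging, (11) p.19, (97) p.32] -/
theorem QTwS_gaugeDir_of_avgSeq (U₀ : GaugeField (F.P K) 0 (Matrix.specialUnitaryGroup (Fin 2) ℂ)) (hS : DifferentiableAt ℂ (logChartTwS F n K h U₀) 0)
    (N : Site (F.P K) 0 → Matrix (Fin 2) (Fin 2) ℂ) (ns : (j : ℕ) → Site (F.P K) j → Matrix (Fin 2) (Fin 2) ℂ) (h0 : ns 0 = N)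
    (hsucc : ∀ (j : ℕ) (y : Site (F.P K) (j + 1)), ns (j + 1) y = ns j (emb y) - B7TransferAnalyticMean.meanCLM (Idx (F.P K)) (Matrix (Fin 2) (Fin 2) ℂ) fun i : Idx (F.P K) =>
        ns j (emb y) - ((holT (emlIterU j (bgUnits F K U₀)) (emb y) (stairWord i.2.1 (off i.1)) : (Matrix (Fin 2) (Fin 2) ℂ)ˣ) : Matrix (Fin 2) (Fin 2) ℂ) *
          ns j (transl (emb y) (disp (stairWord i.2.1 (off i.1)))) * (((holT (emlIterU j (bgUnits F K U₀)) (emb y) (stairWord i.2.1 (off i.1)))⁻¹ : (Matrix (Fin 2) (Fin 2) ℂ)ˣ) : Matrix (Fin 2) (Fin 2) ℂ)) :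
    QTwS F n K h U₀ (fun b : PBond (F.P K) 0 =>
        N b.src - ((bgUnits F K U₀ b : (Matrix (Fin 2) (Fin 2) ℂ)ˣ) : Matrix (Fin 2) (Fin 2) ℂ) * N b.tgt * (((bgUnits F K U₀ b)⁻¹ : (Matrix (Fin 2) (Fin 2) ℂ)ˣ) : Matrix (Fin 2) (Fin 2) ℂ))
      = fun c : PBond (F.P n) 0 =>
        ns (K - n) (bondShift (sites_eq F n K h) c).src
          - ((emlIterU (K - n) (bgUnits F K U₀) (bondShift (sites_eq F n K h) c) : (Matrix (Fin 2) (Fin 2) ℂ)ˣ) : Matrix (Fin 2) (Fin 2) ℂ) * ns (K - n) (bondShift (sites_eq F n K h) c).tgt *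
            (((emlIterU (K - n) (bgUnits F K U₀) (bondShift (sites_eq F n K h) c))⁻¹ : (Matrix (Fin 2) (Fin 2) ℂ)ˣ) : Matrix (Fin 2) (Fin 2) ℂ) := by
  have hg0 : (fun z : Site (F.P K) 0 => expUnit ((0 : ℝ) • N z)) = fun _ => 1 := by
    funext z; apply Units.ext; rw [val_expUnit, zero_smul, exp_zero, Units.val_one]
  have hgd : ∀ z : Site (F.P K) 0, HasDerivAt (fun t : ℝ => ((expUnit (t • N z) : (Matrix (Fin 2) (Fin 2) ℂ)ˣ) : Matrix (Fin 2) (Fin 2) ℂ)) (N z) 0 := fun z => by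
    have h1 := hasDerivAt_exp_smul_const' (𝕂 := ℝ) (N z) (0 : ℝ)
    simp only [zero_smul, exp_zero, mul_one] at h1
    have hfun : (fun t : ℝ => ((expUnit (t • N z) : (Matrix (Fin 2) (Fin 2) ℂ)ˣ) : Matrix (Fin 2) (Fin 2) ℂ)) = fun t => exp (t • N z) := by
      funext t; rw [val_expUnit]
    rw [hfun]; exact h1
  exact QTwS_gaugeDir_of_frameResponse F h U₀ hS N
    (fun x => hasDerivAt_frameAccU_of_avgSeq (bgUnits F K U₀) (g := fun t z => expUnit (t • N z)) hg0 hgd ns h0 hsucc (K - n) x)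

end Closed

end Summit.QuantumFields.YangMills.Theorems.Prop7SymAvgTwSGaugeDir

end
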